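import Mathlib
import Summits.MatrixMultiplication.MatrixMultiplication.Theses.GLnSeparatingDesigns
import Literature.Barriers.MatrixMultiplication.QuasirandomBarrier
import Literature.Combinatorics.Additive.TripleProductProperty

/-!
# Sketch — crux-ideate round 2, ideator 5, crux `BorderHalfDimensionDesigns` (stmt-MatrixMultiplication-18360)

Idea `continuous-quasirandom-law` (lens: negation).  First lemmas / typed statements:

* `HasSeparators`, `pt` — the crux's separator clause (copied from the cdisprove `Disproof.lean`
  so that this file is self-contained).
* `SeparationDegreeLaw` — C⁻, the conjectured uniform GL_n separation-degree law
  `|X||Y||Z| ≤ C(n) · (s+1)^{n(n-1)/2} · C(2s+n², n²)` for every design with η-separators of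
  degree ≤ s (η·volume < 1); exponent `3n²/2 − n/2` = split-design barrier = finite-field
  Gowers bound.  `not_borderHalfDimensionDesigns_of_law` : C⁻ → ¬ crux (numerics, ε* = 1/6).
* `interpolation_scale` — rigorous structural lemma: an alien killer of total degree `< q`
  against FULL affine digit grids propagates to the affine hulls (combinatorial
  Nullstellensatz), the engine of the "open-orbit dichotomy" (Barrier notes B12–B13).
* `finiteFieldShadow` — the finite-field model of the crux is false for ε < 1/6:
  BCGPU23 Thm 3.2 (tree, PROVED) + the minimal degree of `GL_n(𝔽_p)`; typed as the target of
  the mod-p shadow argument (Barrier note B14).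
-/

set_option linter.dupNamespace false

namespace Summit.MatrixMultiplication.MatrixMultiplication.Cruxes.BorderHalfDimensionDesigns.Ideate5

open scoped BigOperators Matrix
open Summit.MatrixMultiplication.MatrixMultiplication.Theses.GLnSeparatingDesigns

abbrev GLn (n : ℕ) := Matrix.GeneralLinearGroup (Fin n) ℂ

/-- The sampled point of a quadruple: the `n²` entries of `x y⁻¹ y' z⁻¹`. -/
def pt {n : ℕ} (x y y' z : GLn n) : Fin n × Fin n → ℂ :=
  fun ij => ((x * y⁻¹ * y' * z⁻¹ : GLn n) : Matrix (Fin n) (Fin n) ℂ) ij.1 ij.2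

/-- η-approximate separating polynomials of total degree `≤ s` for every target (the crux's last
conjunct with an integer degree budget). -/
def HasSeparators {n : ℕ} (X Y Z : Finset (GLn n)) (s : ℕ) (η : ℝ) : Prop :=
  ∀ x₀ ∈ X, ∀ z₀ ∈ Z, ∃ p : MvPolynomial (Fin n × Fin n) ℂ, p.totalDegree ≤ s ∧
    ∀ x ∈ X, ∀ y ∈ Y, ∀ y' ∈ Y, ∀ z ∈ Z,
      ((x = x₀ ∧ y = y' ∧ z = z₀) → ‖MvPolynomial.eval (pt x y y' z) p - 1‖ ≤ η) ∧
      (¬ (x = x₀ ∧ y = y' ∧ z = z₀) → ‖MvPolynomial.eval (pt x y y' z) p‖ ≤ η)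

/-- **C⁻ — the continuous quasirandom (GL_n separation-degree) law.**  For every `n ≥ 2` there is
a constant `C n` such that every finite `X, Y, Z ⊆ GL_n(ℂ)` carrying `η`-separators of degree
`≤ s` with `η · |X||Y||Z| < 1` has volume
`|X|·|Y|·|Z| ≤ C n · (s+1)^{n(n−1)/2} · C(2s+n², n²)` ( = `s^{3n²/2 − n/2 + o(1)}` ).
Conjectured (this card); PROVED for split designs (strategist, `SplitBarrierSketch.lean`) and,
via reduction mod `p`, for exact `q`-smooth-rational designs (Barrier note B14). -/
def SeparationDegreeLaw : Prop :=
  ∀ n : ℕ, 2 ≤ n → ∃ C : ℝ, 0 < C ∧ ∀ s : ℕ, 2 ≤ s → ∀ (X Y Z : Finset (GLn n)) (η : ℝ),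
    η * (X.card * Y.card * Z.card) < 1 → HasSeparators X Y Z s η →
      ((X.card : ℝ) * Y.card * Z.card) ≤
        C * ((s : ℝ) + 1) ^ (n * (n - 1) / 2) * ((2 * s + n ^ 2).choose (n ^ 2) : ℝ)

/-- C⁻ refutes the crux: with `|X|,|Y|,|Z| ≥ q^{n²/2−εn}` and `s ≤ q^{1+δ}` the law reads
`3n²/2 − 3εn ≤ (1+δ)(3n²/2 − n/2) + O_n(1/log q)`, false for `ε = 1/8 < 1/6`, `δ = 1/(16 n)` and
`q` large (same arithmetic as the strategist's corollary for split designs). -/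
theorem not_borderHalfDimensionDesigns_of_law :
    SeparationDegreeLaw → ¬ BorderHalfDimensionDesigns := by
  sorry

/-- **Interpolation-scale lemma (first rigorous lemma of the line).**  Let `x(a) = A₀ + Σ aᵢ Aᵢ`
and `ζ(c) = C₀ + Σ cₖ Cₖ` be affine digit parametrisations and let the digits run over FULL
grids `S^m`, `|S| = q`.  If a polynomial `F` of total degree `< q` kills `x(a) · w · ζ(c)` for all
grid digits, it kills `x(a) · w · ζ(c)` for ALL complex `a, c` (it vanishes on the affine hull).
Proof: `(a,c) ↦ F(x(a) w ζ(c))` has degree `< q` in each variable; combinatorial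
Nullstellensatz (`MvPolynomial.combinatorial_nullstellensatz_exists_eval_nonzero`).
Consequence (open-orbit dichotomy, notes B12–B13): every alien killer of a design with full
affine digit grids as outer sets has degree `≥ q` — the whole difficulty lives at
"interpolation scale" `q ≤ deg ≤ q^{1+δ}`, where Zariski-closure arguments are void. -/
theorem interpolation_scale {n m q : ℕ} (S : Finset ℂ) (hS : S.card = q)
    (A₀ C₀ : Matrix (Fin n) (Fin n) ℂ) (A C : Fin m → Matrix (Fin n) (Fin n) ℂ)
    (w : Matrix (Fin n) (Fin n) ℂ) (F : MvPolynomial (Fin n × Fin n) ℂ) (hF : F.totalDegree < q)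
    (hkill : ∀ a c : Fin m → ℂ, (∀ i, a i ∈ S) → (∀ k, c k ∈ S) →
      MvPolynomial.eval (fun ij : Fin n × Fin n =>
        ((A₀ + ∑ i, a i • A i) * w * (C₀ + ∑ k, c k • C k)) ij.1 ij.2) F = 0) :
    ∀ a c : Fin m → ℂ,
      MvPolynomial.eval (fun ij : Fin n × Fin n =>
        ((A₀ + ∑ i, a i • A i) * w * (C₀ + ∑ k, c k • C k)) ij.1 ij.2) F = 0 := by
  sorry

/-- **Finite-field shadow of the crux is false below ε = 1/6** (target of the mod-`p` reduction,
note B14): in `GL_n(𝔽_p)`, `n ≥ 3`, every TPP triple has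
`|S||T||U| ≤ |G|^{3/2} / n(G)^{1/2} + |G|` (BCGPU 2023 Thm 3.2, tree `BCGPU2023_thm32_holds`)
with `n(G) ≥ p^{n−1}` (minimal degree of `GL_n(𝔽_p)`, `p ≥ 5`, Landazuri–Seitz / Tiep–Zalesskii; cite
fact to vendor) and `|G| < p^{n²}`, i.e. volume `≤ p^{3n²/2−(n−1)/2} + p^{n²} ≤ 2·p^{3n²/2 − (n−1)/2}`:
the SAME exponent `3n²/2 − n/2 + O(1)` as C⁻. -/
def FiniteFieldShadow : Prop :=
  ∀ (p : ℕ) [Fact p.Prime] (n : ℕ), 5 ≤ p → 3 ≤ n →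
    ∀ S T U : Finset (Matrix.GeneralLinearGroup (Fin n) (ZMod p)),
      Literature.Combinatorics.Additive.TripleProductProperty S T U →
        ((S.card * T.card * U.card : ℕ) : ℝ) ≤
          2 * (p : ℝ) ^ ((3 : ℝ) * n ^ 2 / 2 - ((n : ℝ) - 1) / 2)

/-- The minimal-degree input that turns `BCGPU2023_thm32` into `FiniteFieldShadow`
(Landazuri–Seitz 1974 / Tiep–Zalesskii: the smallest degree `> 1` of a complex irreducible
representation of `GL_n(𝔽_p)`, `n ≥ 3`, is `(pⁿ − p)/(p − 1) ≥ p^{n−1}` apart from the small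
exceptions `(n,p) ∈ {(3,2),(4,2),(4,3)}` of Tiep–Zalesskii — excluded here by `p ≥ 5`; an irreducible
representation of `GL_n` of dimension `> 1` restricts non-trivially to `SL_n`, Clifford theory).
Cite fact, unvendored. -/
def GLnMinDegree : Prop :=
  ∀ (p : ℕ) [Fact p.Prime] (n : ℕ), 5 ≤ p → 3 ≤ n →
    (p : ℝ) ^ (n - 1) ≤
      (Literature.Barriers.MatrixMultiplication.secondCharDegree
        (Matrix.GeneralLinearGroup (Fin n) (ZMod p)) : ℝ)

theorem finiteFieldShadow_of_minDegree
    (h32 : Literature.Barriers.MatrixMultiplication.BCGPU2023_thm32) (hmin : GLnMinDegree) :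
    FiniteFieldShadow := by
  sorry

end Summit.MatrixMultiplication.MatrixMultiplication.Cruxes.BorderHalfDimensionDesigns.Ideate5
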